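import Summits.QuantumFields.YangMills.Theorems.ColdStartUniversalityLatticeLangevinReverseLocalPoincare
import Summits.QuantumFields.YangMills.Theorems.ColdStartUniversalityShenZhuZhuW1DiracContractionSU2
import Summits.QuantumFields.YangMills.Theorems.ColdStartUniversalityLatticeLangevinRiemannLipschitzFunctionalInequalitiesAllLipschitz
import HarnessLib

/-!
# The STRONG FELLER property of the `SU(2)` lattice Langevin semigroup in total-variation–Lipschitz form, uniformly in the volume:
# `|κ_t G(Q) − κ_t G(Q')| ≤ √((1−12|β'|)/(e^(2(1−12|β'|)t) − 1))·‖G‖_∞·ρ_L(Q,Q')` for every bounded semicontinuous `G`, `t > 0`, `|β'| < 1/12`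

Seat `ym-line-csu-p1` (g42), route `ColdStartUniversality` of `Summits/QuantumFields/YangMills`, helper file G61 (`--supports stmt-QuantumFields-24809`).
g29's reverse local Poincaré inequality (`wilson_lipschitz_smoothing_uniform`: `Γ^A(κ_t F)(x) ≤ (c/(e^(ct) − 1))·M²` for `C⁵` cylinders `|F| ≤ M`,
`c = 2(1 − 12|β'|)`) and G42 (`Γ^A ≤ σ²` ⇒ `√(σ²/2)`-Lipschitz in `ρ_L`) say that after any positive time the semigroup turns BOUNDED observables into
`ρ_L`-LIPSCHITZ ones, with a constant that sees only the sup norm.  This file removes the smoothness: by mollification (G56) the bound passes to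
every `ρ_L`-Lipschitz observable, and by monotone approximation from above (Baire's construction `G_k = sup_w (G(w) − k·ρ_L(·,w))`, a generic
metric-space lemma proved here) to every bounded UPPER SEMICONTINUOUS observable — in particular to every bounded continuous one and, by
reflection, to every bounded lower semicontinuous one.  Consequence: `x ↦ κ_t(x, ·)` is `ρ_L`-Lipschitz in total variation on semicontinuous test
functions (strong Feller property with an explicit, volume-independent modulus `C_t = √((1−12|β'|)/(e^(2(1−12|β'|)t) − 1)) ~ 1/√(2t)`).

* ★ `exists_lipschitz_majorants_of_upperSemicontinuous` — generic: a bounded u.s.c. `G ≥ 0` on a pseudo-metric space is the pointwise limit of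
  `k`-Lipschitz majorants `G ≤ G_k ≤ sup G`;
* ★★ `wilson_strongFeller_smooth` — `C⁵` cylinders: `|κ_t(f∘coords)(Q') − κ_t(f∘coords)(Q)| ≤ C_t·M·ρ_L(Q,Q')` for `|f∘coords| ≤ M`;
* ★★ `wilson_strongFeller_lipschitz` — the same for every `ρ_L`-Lipschitz `F` with `|F| ≤ M` (the Lipschitz constant does not enter);
* ★★★ `wilson_strongFeller_upperSemicontinuous` — the same for every upper semicontinuous `G` with `0 ≤ G ≤ M`;
* ★★★ `wilson_strongFeller_continuous` / `wilson_strongFeller_lowerSemicontinuous` — corollaries.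

THEOREMS ONLY, no definition, no sorry.  HONEST FRAMING: fixed cut-off, `|β'| < 1/12`, `t > 0`; "uniform" = in `L`; nothing `K`-uniform along the
route's scaling; `UniformColdStartMixing` (24809, ASIDE) is not restated; no crux, rung or summit statement is proved; the Yang–Mills mass gap is NOT
proved.
-/

set_option autoImplicit false

noncomputable section

namespace Summit.QuantumFields.YangMills.Theorems.ColdStartUniversality

open MeasureTheory ProbabilityTheory Matrix Complex Finset Filter Topology Set Metric
open scoped BigOperators Real NNReal
open Literature.MathematicalPhysics.QuantumFieldTheory
open Literature.MathematicalPhysics.QuantumLattice (fundamentalRep fundamentalLatticeRep continuous_fundamentalRep fundamentalRep_apply fundamentalLatticeRep_N)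

/-! ## §1. Lipschitz majorants of upper semicontinuous functions (generic) -/

/-- ★ **Baire's Lipschitz majorants.**  On a pseudo-metric space, an upper semicontinuous `G` with `0 ≤ G ≤ M` admits, for every `k : ℕ`, the
`k`-Lipschitz majorant `G_k(z) = sup_w (G(w) − k·dist(z,w))` with `G ≤ G_k ≤ M`, and `G_k(z) → G(z)` for every `z`. [folklore] -/
theorem exists_lipschitz_majorants_of_upperSemicontinuous {X : Type*} [PseudoMetricSpace X]
    {G : X → ℝ} (hG : UpperSemicontinuous G) {M : ℝ} (h0 : ∀ z, 0 ≤ G z) (hM : ∀ z, G z ≤ M) :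
    ∃ Gk : ℕ → X → ℝ, (∀ k z, G z ≤ Gk k z) ∧ (∀ k z, Gk k z ≤ M) ∧
      (∀ k z z', |Gk k z - Gk k z'| ≤ k * dist z z') ∧ (∀ z, Tendsto (fun k => Gk k z) atTop (𝓝 (G z))) := by
  have hne : ∀ z : X, Nonempty X := fun z => ⟨z⟩
  have hbdd : ∀ (k : ℕ) (z : X), BddAbove (Set.range fun w => G w - k * dist z w) := fun k z =>
    ⟨M, by
      rintro _ ⟨w, rfl⟩
      show G w - k * dist z w ≤ M
      nlinarith [hM w, dist_nonneg (x := z) (y := w), (Nat.cast_nonneg k : (0:ℝ) ≤ k)]⟩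
  refine ⟨fun k z => ⨆ w, (G w - k * dist z w), fun k z => ?_, fun k z => ?_, fun k z z' => ?_, fun z => ?_⟩
  · haveI := hne z
    have h := le_ciSup (hbdd k z) z
    simp only [dist_self, mul_zero, sub_zero] at h
    exact h
  · haveI := hne z
    exact ciSup_le fun w => by nlinarith [hM w, dist_nonneg (x := z) (y := w)]
  · haveI := hne z
    have key : ∀ z z' : X, (⨆ w, (G w - k * dist z w)) ≤ (⨆ w, (G w - k * dist z' w)) + k * dist z z' := by
      intro z z'
      refine ciSup_le fun w => ?_
      have h1 : G w - k * dist z' w ≤ ⨆ w, (G w - k * dist z' w) := le_ciSup (hbdd k z') w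
      have h2 : dist z' w ≤ dist z z' + dist z w := by
        have := dist_triangle z' z w; rw [dist_comm z' z] at this; exact this
      have hk : (0 : ℝ) ≤ k := Nat.cast_nonneg k
      nlinarith [mul_le_mul_of_nonneg_left h2 hk]
    rw [abs_le]
    constructor
    · have := key z' z; rw [dist_comm z' z] at this; linarith
    · linarith [key z z']
  · haveI := hne z
    rw [Metric.tendsto_atTop]
    intro ε hε
    have husc : ∀ᶠ w in 𝓝 z, G w < G z + ε / 2 := hG z (G z + ε / 2) (by linarith)
    obtain ⟨δ, hδ, hball⟩ := Metric.eventually_nhds_iff.1 husc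
    obtain ⟨N, hN⟩ := exists_nat_gt (M / δ)
    refine ⟨N, fun k hk => ?_⟩
    have hkδ : M ≤ k * δ := by
      have hk' : (M / δ) < k := lt_of_lt_of_le hN (by exact_mod_cast hk)
      rw [div_lt_iff₀ hδ] at hk'
      exact hk'.le
    have hlow : G z ≤ ⨆ w, (G w - k * dist z w) := by
      have h := le_ciSup (hbdd k z) z
      simp only [dist_self, mul_zero, sub_zero] at h
      exact h
    have hup : (⨆ w, (G w - k * dist z w)) ≤ G z + ε / 2 := by
      refine ciSup_le fun w => ?_
      by_cases hw : dist w z < δ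
      · have := hball hw
        nlinarith [dist_nonneg (x := z) (y := w), (Nat.cast_nonneg k : (0:ℝ) ≤ k)]
      · push Not at hw
        rw [dist_comm] at hw
        have hk0 : (0 : ℝ) ≤ k := Nat.cast_nonneg k
        have : k * δ ≤ k * dist z w := mul_le_mul_of_nonneg_left hw hk0
        linarith [hM w, h0 z]
    rw [Real.dist_eq, abs_lt]
    constructor <;> linarith

/-! ## §2. Smooth cylinders: the reverse local Poincaré inequality as a `ρ_L`-Lipschitz bound -/

variable {L : ℕ} [NeZero L]

/-- ★★ **Strong Feller, smooth cylinders.**  For `|β'| < 1/12`, `t > 0`, every realising kernel family `κ` and every `C⁵` `f` with `|f∘coords| ≤ M`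
on the group:  `|κ_t(f∘coords)(Q') − κ_t(f∘coords)(Q)| ≤ √((1−12|β'|)/(e^(2(1−12|β'|)t) − 1))·M·ρ_L(Q,Q')` — the derivatives of `f` do not enter
(g29's `wilson_lipschitz_smoothing_uniform` + G42). [cite: BakryGentilLedoux2014, Thm 4.7.2 (iii) / (4.7.6)] -/
theorem wilson_strongFeller_smooth (L : ℕ) [NeZero L] (β' : ℝ) (hβ : |β'| < 1 / 12)
    (κ : ℝ≥0 → Kernel (GaugeConfig 3 L (Matrix.specialUnitaryGroup (Fin 2) ℂ))
      (GaugeConfig 3 L (Matrix.specialUnitaryGroup (Fin 2) ℂ))) [∀ t, IsMarkovKernel (κ t)]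
    (hreal : ∀ (t : ℝ≥0) (x : GaugeConfig 3 L (Matrix.specialUnitaryGroup (Fin 2) ℂ))
        (Ω : Type) [MeasurableSpace Ω] (P : Measure Ω) [IsProbabilityMeasure P]
        (W : ℝ≥0 → Ω → (Edge 3 L × NoiseIdx 2 → ℝ)) (hW : IsFlatBrownian W P)
        (U : ℝ≥0 → Ω → GaugeConfig 3 L (Matrix.specialUnitaryGroup (Fin 2) ℂ)),
        (∀ ω, U 0 ω = x) →
        (latticeLangevinDynamics (fundamentalLatticeRep 2) β').IsSolution (fundamentalRep (Fin 2))
          hW.natFiltration P W U →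
        κ t x = P.map (U t))
    {f : (Edge 3 L × Fin 2 × Fin 2 × Bool → ℝ) → ℝ} (hf : ContDiff ℝ 5 f) {M : ℝ} {t : ℝ≥0} (ht : 0 < (t : ℝ)) :
    let coords : GaugeConfig 3 L (Matrix.specialUnitaryGroup (Fin 2) ℂ) → (Edge 3 L × Fin 2 × Fin 2 × Bool → ℝ) :=
      fun V q => (fun z : ℂ => if q.2.2.2 then z.im else z.re)
        ((fundamentalRep (Fin 2) (V q.1) : Matrix (Fin 2) (Fin 2) ℂ) q.2.1 q.2.2.1)
    (∀ y, |f (coords y)| ≤ M) →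
    ∀ Q Q' : GaugeConfig 3 L (Matrix.specialUnitaryGroup (Fin 2) ℂ),
      |∫ y, f (coords y) ∂(κ t Q') - ∫ y, f (coords y) ∂(κ t Q)| ≤
        Real.sqrt ((1 - 12 * |β'|) / (Real.exp (2 * (1 - 12 * |β'|) * (t : ℝ)) - 1)) * M *
          Real.sqrt (torusRiemannDistSq (fundamentalLatticeRep 2) Q Q') := by
  intro coords hM Q Q'
  obtain ⟨g, hg, -, hrep, hΓ⟩ := wilson_lipschitz_smoothing_uniform L β' hβ κ hreal hf (M := M) ht hM
  have hM0 : 0 ≤ M := (abs_nonneg _).trans (hM Q)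
  have h := abs_sub_le_sqrt_carre_mul_sqrt_torusRiemannDistSq L β' (hg.differentiable (by norm_num))
    (σ2 := (2 * (1 - 12 * |β'|)) / (Real.exp (2 * (1 - 12 * |β'|) * (t : ℝ)) - 1) * M ^ 2) hΓ Q Q'
  rw [hrep Q', hrep Q]
  have hsq : Real.sqrt ((2 * (1 - 12 * |β'|)) / (Real.exp (2 * (1 - 12 * |β'|) * (t : ℝ)) - 1) * M ^ 2 / 2) =
      Real.sqrt ((1 - 12 * |β'|) / (Real.exp (2 * (1 - 12 * |β'|) * (t : ℝ)) - 1)) * M := by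
    rw [show (2 * (1 - 12 * |β'|)) / (Real.exp (2 * (1 - 12 * |β'|) * (t : ℝ)) - 1) * M ^ 2 / 2 =
      (1 - 12 * |β'|) / (Real.exp (2 * (1 - 12 * |β'|) * (t : ℝ)) - 1) * M ^ 2 by ring,
      Real.sqrt_mul' _ (sq_nonneg M), Real.sqrt_sq hM0]
  rw [hsq] at h
  exact h

/-! ## §3. Every `ρ_L`-Lipschitz observable -/

/-- ★★ **Strong Feller, Lipschitz observables.**  For `|β'| < 1/12`, `t > 0` and every `F : SU(2)^E → ℝ` that is `ρ_L`-Lipschitz (any constant)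
with `|F| ≤ M`:  `|κ_t F(Q') − κ_t F(Q)| ≤ √((1−12|β'|)/(e^(2(1−12|β'|)t) − 1))·M·ρ_L(Q,Q')` (mollify with G56, apply §2, let `r → 0`).
[cite: BakryGentilLedoux2014, Thm 4.7.2 (iii) / (4.7.6)] -/
theorem wilson_strongFeller_lipschitz (L : ℕ) [NeZero L] (β' : ℝ) (hβ : |β'| < 1 / 12)
    (κ : ℝ≥0 → Kernel (GaugeConfig 3 L (Matrix.specialUnitaryGroup (Fin 2) ℂ))
      (GaugeConfig 3 L (Matrix.specialUnitaryGroup (Fin 2) ℂ))) [∀ t, IsMarkovKernel (κ t)]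
    (hreal : ∀ (t : ℝ≥0) (x : GaugeConfig 3 L (Matrix.specialUnitaryGroup (Fin 2) ℂ))
        (Ω : Type) [MeasurableSpace Ω] (P : Measure Ω) [IsProbabilityMeasure P]
        (W : ℝ≥0 → Ω → (Edge 3 L × NoiseIdx 2 → ℝ)) (hW : IsFlatBrownian W P)
        (U : ℝ≥0 → Ω → GaugeConfig 3 L (Matrix.specialUnitaryGroup (Fin 2) ℂ)),
        (∀ ω, U 0 ω = x) →
        (latticeLangevinDynamics (fundamentalLatticeRep 2) β').IsSolution (fundamentalRep (Fin 2))
          hW.natFiltration P W U →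
        κ t x = P.map (U t))
    {F : GaugeConfig 3 L (Matrix.specialUnitaryGroup (Fin 2) ℂ) → ℝ} {Lf : ℝ} (hLf : 0 ≤ Lf)
    (hlip : ∀ Q Q', |F Q' - F Q| ≤ Lf * Real.sqrt (torusRiemannDistSq (fundamentalLatticeRep 2) Q Q'))
    {M : ℝ} (hM : ∀ y, |F y| ≤ M) {t : ℝ≥0} (ht : 0 < (t : ℝ))
    (Q Q' : GaugeConfig 3 L (Matrix.specialUnitaryGroup (Fin 2) ℂ)) :
    |∫ y, F y ∂(κ t Q') - ∫ y, F y ∂(κ t Q)| ≤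
      Real.sqrt ((1 - 12 * |β'|) / (Real.exp (2 * (1 - 12 * |β'|) * (t : ℝ)) - 1)) * M *
        Real.sqrt (torusRiemannDistSq (fundamentalLatticeRep 2) Q Q') := by
  let coords : GaugeConfig 3 L (Matrix.specialUnitaryGroup (Fin 2) ℂ) → (Edge 3 L × Fin 2 × Fin 2 × Bool → ℝ) :=
    fun V q => (fun z : ℂ => if q.2.2.2 then z.im else z.re) ((fundamentalRep (Fin 2) (V q.1) : Matrix (Fin 2) (Fin 2) ℂ) q.2.1 q.2.2.1)
  haveI := borelSpace_config L
  set C : ℝ := Real.sqrt ((1 - 12 * |β'|) / (Real.exp (2 * (1 - 12 * |β'|) * (t : ℝ)) - 1)) with hCdef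
  set D : ℝ := Real.sqrt (torusRiemannDistSq (fundamentalLatticeRep 2) Q Q') with hDdef
  have hC0 : 0 ≤ C := Real.sqrt_nonneg _
  have hD0 : 0 ≤ D := Real.sqrt_nonneg _
  have hM0 : 0 ≤ M := (abs_nonneg _).trans (hM Q)
  have hFc : Continuous F := continuous_of_riemannLipschitz hlip
  set E : ℝ := Real.sqrt (Fintype.card (Edge 3 L)) with hEdef
  have hE0 : 0 ≤ E := Real.sqrt_nonneg _
  refine le_of_forall_pos_le_add fun ε hε => ?_
  -- error budget `r·B ≤ ε`, `B = 24·L_F·E + C·12·L_F·E·D + 1`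
  set B : ℝ := 24 * Lf * E + C * (12 * Lf * E) * D + 1 with hBdef
  have hB : 0 < B := by positivity
  set r : ℝ := min (1 / 4) (ε / B) with hrdef
  have hr0 : 0 < r := lt_min (by norm_num) (div_pos hε hB)
  have hr : r ≤ 1 / 4 := min_le_left _ _
  have hrB : r * B ≤ ε := by
    have := min_le_right (1 / 4 : ℝ) (ε / B)
    rwa [← hrdef, le_div_iff₀ hB] at this
  obtain ⟨g, hg, happrox', -⟩ := exists_smooth_riemannLipschitz_approx L hLf hlip hr0 hr
  have happrox : ∀ P, |g (coords P) - F P| ≤ Lf * (12 * E * r) := happrox'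
  -- `|g∘coords| ≤ M + 12·L_F·E·r`
  have hgM : ∀ y : GaugeConfig 3 L (Matrix.specialUnitaryGroup (Fin 2) ℂ),
      |g (coords y)| ≤
        M + Lf * (12 * E * r) := fun y => by
    have h1 := happrox y
    have h2 := hM y
    have h3 := abs_add_le (g (coords y) - F y) (F y)
    rw [sub_add_cancel] at h3
    linarith
  have hsmooth := wilson_strongFeller_smooth L β' hβ κ hreal hg (M := M + Lf * (12 * E * r)) ht hgM Q Q'
  -- `|∫F dκ − ∫g∘coords dκ| ≤ 12·L_F·E·r` at both points
  have hco : Continuous coords := continuous_coords (L := L)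
  have hint : ∀ P : GaugeConfig 3 L (Matrix.specialUnitaryGroup (Fin 2) ℂ),
      |∫ y, F y ∂(κ t P) - ∫ y, g (coords y) ∂(κ t P)| ≤
        Lf * (12 * E * r) := by
    intro P
    have hFi : Integrable F (κ t P) := hFc.integrable_of_hasCompactSupport (HasCompactSupport.of_compactSpace F)
    have hgi : Integrable (fun y => g (coords y)) (κ t P) :=
      (hg.continuous.comp hco).integrable_of_hasCompactSupport (HasCompactSupport.of_compactSpace _)
    rw [← integral_sub hFi hgi]
    calc _ ≤ ∫ y, |F y - g (coords y)| ∂(κ t P) :=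
          abs_integral_le_integral_abs
      _ ≤ ∫ _y, Lf * (12 * E * r) ∂(κ t P) :=
          integral_mono_of_nonneg (ae_of_all _ fun _ => abs_nonneg _) (integrable_const _)
            (ae_of_all _ fun y => (abs_sub_comm _ _).trans_le (happrox y))
      _ = Lf * (12 * E * r) := by rw [integral_const, probReal_univ, one_smul]
  have h1 := hint Q
  have h2 := hint Q'
  have h3 := abs_sub_le (∫ y, F y ∂(κ t Q')) (∫ y, g (coords y) ∂(κ t Q')) (∫ y, F y ∂(κ t Q))
  have h4 := abs_sub_le (∫ y, g (coords y) ∂(κ t Q'))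
    (∫ y, g (coords y) ∂(κ t Q)) (∫ y, F y ∂(κ t Q))
  have h5 : |∫ y, g (coords y) ∂(κ t Q) - ∫ y, F y ∂(κ t Q)| ≤
      Lf * (12 * E * r) := by rw [abs_sub_comm]; exact h1
  calc |∫ y, F y ∂(κ t Q') - ∫ y, F y ∂(κ t Q)| ≤ Lf * (12 * E * r) + (C * (M + Lf * (12 * E * r)) * D + Lf * (12 * E * r)) := by
        linarith [hsmooth]
    _ = C * M * D + r * (24 * Lf * E + C * (12 * Lf * E) * D) := by ring
    _ ≤ C * M * D + r * B := by
        have : 24 * Lf * E + C * (12 * Lf * E) * D ≤ B := by rw [hBdef]; linarith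
        nlinarith
    _ ≤ C * M * D + ε := by linarith

/-! ## §4. Every bounded upper semicontinuous observable: the strong Feller property -/

/-- ★★★ **Strong Feller property in `ρ_L`-Lipschitz form.**  For `|β'| < 1/12`, `t > 0`, every realising kernel family `κ` and every UPPER
SEMICONTINUOUS `G : SU(2)^E → ℝ` with `0 ≤ G ≤ M`:  `|κ_t G(Q') − κ_t G(Q)| ≤ √((1−12|β'|)/(e^(2(1−12|β'|)t) − 1))·M·ρ_L(Q,Q')`.  Proof: §1 gives
`k`-Lipschitz majorants `G_k ↓ G` (for the metric `ρ_L`, which induces the product topology, G58), §3 applies to each, and dominated convergence.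
[cite: BakryGentilLedoux2014, Thm 4.7.2 (iii) / (4.7.6)] -/
theorem wilson_strongFeller_upperSemicontinuous (L : ℕ) [NeZero L] (β' : ℝ) (hβ : |β'| < 1 / 12)
    (κ : ℝ≥0 → Kernel (GaugeConfig 3 L (Matrix.specialUnitaryGroup (Fin 2) ℂ))
      (GaugeConfig 3 L (Matrix.specialUnitaryGroup (Fin 2) ℂ))) [∀ t, IsMarkovKernel (κ t)]
    (hreal : ∀ (t : ℝ≥0) (x : GaugeConfig 3 L (Matrix.specialUnitaryGroup (Fin 2) ℂ))
        (Ω : Type) [MeasurableSpace Ω] (P : Measure Ω) [IsProbabilityMeasure P]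
        (W : ℝ≥0 → Ω → (Edge 3 L × NoiseIdx 2 → ℝ)) (hW : IsFlatBrownian W P)
        (U : ℝ≥0 → Ω → GaugeConfig 3 L (Matrix.specialUnitaryGroup (Fin 2) ℂ)),
        (∀ ω, U 0 ω = x) →
        (latticeLangevinDynamics (fundamentalLatticeRep 2) β').IsSolution (fundamentalRep (Fin 2))
          hW.natFiltration P W U →
        κ t x = P.map (U t))
    {G : GaugeConfig 3 L (Matrix.specialUnitaryGroup (Fin 2) ℂ) → ℝ} (hG : UpperSemicontinuous G)
    {M : ℝ} (h0 : ∀ y, 0 ≤ G y) (hM : ∀ y, G y ≤ M) {t : ℝ≥0} (ht : 0 < (t : ℝ))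
    (Q Q' : GaugeConfig 3 L (Matrix.specialUnitaryGroup (Fin 2) ℂ)) :
    |∫ y, G y ∂(κ t Q') - ∫ y, G y ∂(κ t Q)| ≤
      Real.sqrt ((1 - 12 * |β'|) / (Real.exp (2 * (1 - 12 * |β'|) * (t : ℝ)) - 1)) * M *
        Real.sqrt (torusRiemannDistSq (fundamentalLatticeRep 2) Q Q') := by
  classical
  haveI := secondCountableTopology_su2
  haveI := borelSpace_config L
  -- `SU(2)^E` as a metric space for `ρ_L`, with its given topology (G58)
  have hzero : ∀ x y : GaugeConfig 3 L (Matrix.specialUnitaryGroup (Fin 2) ℂ), Real.sqrt (torusRiemannDistSq (fundamentalLatticeRep 2) x y) = 0 ↔ x = y := fun x y => by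
    have h0' : 0 ≤ torusRiemannDistSq (fundamentalLatticeRep 2) x y := by
      unfold torusRiemannDistSq; exact Finset.sum_nonneg fun _ _ => sq_nonneg _
    rw [Real.sqrt_eq_zero h0', torusRiemannDistSq_two_eq_zero_iff]
  have hself : ∀ x : GaugeConfig 3 L (Matrix.specialUnitaryGroup (Fin 2) ℂ), Real.sqrt (torusRiemannDistSq (fundamentalLatticeRep 2) x x) = 0 := fun x => (hzero x x).2 rfl
  have hcomm : ∀ x y : GaugeConfig 3 L (Matrix.specialUnitaryGroup (Fin 2) ℂ), Real.sqrt (torusRiemannDistSq (fundamentalLatticeRep 2) x y) = Real.sqrt (torusRiemannDistSq (fundamentalLatticeRep 2) y x) :=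
    fun x y => by rw [torusRiemannDistSq_two_comm]
  have htri : ∀ x y z : GaugeConfig 3 L (Matrix.specialUnitaryGroup (Fin 2) ℂ), Real.sqrt (torusRiemannDistSq (fundamentalLatticeRep 2) x z) ≤
      Real.sqrt (torusRiemannDistSq (fundamentalLatticeRep 2) x y) + Real.sqrt (torusRiemannDistSq (fundamentalLatticeRep 2) y z) :=
    fun x y z => sqrt_torusRiemannDistSq_two_triangle x y z
  letI : MetricSpace (GaugeConfig 3 L (Matrix.specialUnitaryGroup (Fin 2) ℂ)) :=
    { __ := PseudoMetricSpace.ofDistTopology (fun x y : GaugeConfig 3 L (Matrix.specialUnitaryGroup (Fin 2) ℂ) => Real.sqrt (torusRiemannDistSq (fundamentalLatticeRep 2) x y))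
        hself hcomm htri isOpen_iff_riemannDist_ball,
      eq_of_dist_eq_zero := fun {x y} h => (hzero x y).1 h }
  obtain ⟨Gk, hGk1, hGk2, hGk3, hGk4⟩ := exists_lipschitz_majorants_of_upperSemicontinuous hG h0 hM
  -- §3 for each majorant
  have hk : ∀ k : ℕ, |∫ y, Gk k y ∂(κ t Q') - ∫ y, Gk k y ∂(κ t Q)| ≤
      Real.sqrt ((1 - 12 * |β'|) / (Real.exp (2 * (1 - 12 * |β'|) * (t : ℝ)) - 1)) * M *
        Real.sqrt (torusRiemannDistSq (fundamentalLatticeRep 2) Q Q') := by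
    intro k
    have hlipk : ∀ P P' : GaugeConfig 3 L (Matrix.specialUnitaryGroup (Fin 2) ℂ), |Gk k P' - Gk k P| ≤ k * Real.sqrt (torusRiemannDistSq (fundamentalLatticeRep 2) P P') :=
      fun P P' => by rw [abs_sub_comm]; exact hGk3 k P P'
    have hMk : ∀ y, |Gk k y| ≤ M := fun y => by
      rw [abs_of_nonneg ((h0 y).trans (hGk1 k y))]; exact hGk2 k y
    exact wilson_strongFeller_lipschitz L β' hβ κ hreal (Nat.cast_nonneg k) hlipk hMk ht Q Q'
  -- dominated convergence `∫G_k dκ → ∫G dκ`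
  have hlim : ∀ P : GaugeConfig 3 L (Matrix.specialUnitaryGroup (Fin 2) ℂ), Tendsto (fun k => ∫ y, Gk k y ∂(κ t P)) atTop (𝓝 (∫ y, G y ∂(κ t P))) := by
    intro P
    refine tendsto_integral_of_dominated_convergence (fun _ => M) (fun k => ?_) (integrable_const M) (fun k => ae_of_all _ fun y => ?_)
      (ae_of_all _ fun y => hGk4 y)
    · have hc : Continuous (Gk k) := by
        refine continuous_iff_continuousAt.2 fun y => Metric.continuousAt_iff.2 fun ε hε => ⟨ε / ((k : ℝ) + 1), by positivity, fun y' hy' => ?_⟩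
        rw [Real.dist_eq]
        calc |Gk k y' - Gk k y| ≤ k * dist y' y := hGk3 k y' y
          _ ≤ ((k : ℝ) + 1) * dist y' y := mul_le_mul_of_nonneg_right (by linarith) dist_nonneg
          _ < ((k : ℝ) + 1) * (ε / ((k : ℝ) + 1)) := mul_lt_mul_of_pos_left hy' (by positivity)
          _ = ε := by field_simp
      exact hc.aestronglyMeasurable
    · rw [Real.norm_eq_abs, abs_of_nonneg ((h0 y).trans (hGk1 k y))]; exact hGk2 k y
  have hlim2 : Tendsto (fun k => |∫ y, Gk k y ∂(κ t Q') - ∫ y, Gk k y ∂(κ t Q)|) atTop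
      (𝓝 (|∫ y, G y ∂(κ t Q') - ∫ y, G y ∂(κ t Q)|)) := ((hlim Q').sub (hlim Q)).abs
  exact le_of_tendsto' hlim2 hk

/-- ★★★ **Strong Feller property for bounded continuous observables**: `|κ_t G(Q') − κ_t G(Q)| ≤ C_t·(2M)·ρ_L(Q,Q')` for every continuous `G`
with `|G| ≤ M`, `C_t = √((1−12|β'|)/(e^(2(1−12|β'|)t) − 1))` (apply §4 to `G + M`, continuous hence u.s.c., `0 ≤ G + M ≤ 2M`; the constant shift
cancels in the difference). [cite: BakryGentilLedoux2014, Thm 4.7.2 (iii) / (4.7.6)] -/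
theorem wilson_strongFeller_continuous (L : ℕ) [NeZero L] (β' : ℝ) (hβ : |β'| < 1 / 12)
    (κ : ℝ≥0 → Kernel (GaugeConfig 3 L (Matrix.specialUnitaryGroup (Fin 2) ℂ))
      (GaugeConfig 3 L (Matrix.specialUnitaryGroup (Fin 2) ℂ))) [∀ t, IsMarkovKernel (κ t)]
    (hreal : ∀ (t : ℝ≥0) (x : GaugeConfig 3 L (Matrix.specialUnitaryGroup (Fin 2) ℂ))
        (Ω : Type) [MeasurableSpace Ω] (P : Measure Ω) [IsProbabilityMeasure P]
        (W : ℝ≥0 → Ω → (Edge 3 L × NoiseIdx 2 → ℝ)) (hW : IsFlatBrownian W P)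
        (U : ℝ≥0 → Ω → GaugeConfig 3 L (Matrix.specialUnitaryGroup (Fin 2) ℂ)),
        (∀ ω, U 0 ω = x) →
        (latticeLangevinDynamics (fundamentalLatticeRep 2) β').IsSolution (fundamentalRep (Fin 2))
          hW.natFiltration P W U →
        κ t x = P.map (U t))
    {G : GaugeConfig 3 L (Matrix.specialUnitaryGroup (Fin 2) ℂ) → ℝ} (hG : Continuous G)
    {M : ℝ} (hM : ∀ y, |G y| ≤ M) {t : ℝ≥0} (ht : 0 < (t : ℝ))
    (Q Q' : GaugeConfig 3 L (Matrix.specialUnitaryGroup (Fin 2) ℂ)) :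
    |∫ y, G y ∂(κ t Q') - ∫ y, G y ∂(κ t Q)| ≤
      Real.sqrt ((1 - 12 * |β'|) / (Real.exp (2 * (1 - 12 * |β'|) * (t : ℝ)) - 1)) * (2 * M) *
        Real.sqrt (torusRiemannDistSq (fundamentalLatticeRep 2) Q Q') := by
  haveI := borelSpace_config L
  have h0 : ∀ y, 0 ≤ G y + M := fun y => by have := hM y; rw [abs_le] at this; linarith
  have h2 : ∀ y, G y + M ≤ 2 * M := fun y => by have := hM y; rw [abs_le] at this; linarith
  have husc : UpperSemicontinuous fun y => G y + M := (hG.add continuous_const).upperSemicontinuous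
  have h := wilson_strongFeller_upperSemicontinuous L β' hβ κ hreal husc h0 h2 ht Q Q'
  have hGi : ∀ P : GaugeConfig 3 L (Matrix.specialUnitaryGroup (Fin 2) ℂ), Integrable G (κ t P) := fun P =>
    hG.integrable_of_hasCompactSupport (HasCompactSupport.of_compactSpace G)
  have hshift : ∀ P : GaugeConfig 3 L (Matrix.specialUnitaryGroup (Fin 2) ℂ), ∫ y, (G y + M) ∂(κ t P) = ∫ y, G y ∂(κ t P) + M := fun P => by
    rw [integral_add (hGi P) (integrable_const M), integral_const, probReal_univ, one_smul]
  rw [hshift Q', hshift Q] at h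
  rwa [show ∫ y, G y ∂(κ t Q') + M - (∫ y, G y ∂(κ t Q) + M) = ∫ y, G y ∂(κ t Q') - ∫ y, G y ∂(κ t Q) by ring] at h

/-- ★★★ **Strong Feller property for bounded lower semicontinuous observables** (`M − G` is upper semicontinuous with `0 ≤ M − G ≤ M`).
[cite: BakryGentilLedoux2014, Thm 4.7.2 (iii) / (4.7.6)] -/
theorem wilson_strongFeller_lowerSemicontinuous (L : ℕ) [NeZero L] (β' : ℝ) (hβ : |β'| < 1 / 12)
    (κ : ℝ≥0 → Kernel (GaugeConfig 3 L (Matrix.specialUnitaryGroup (Fin 2) ℂ))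
      (GaugeConfig 3 L (Matrix.specialUnitaryGroup (Fin 2) ℂ))) [∀ t, IsMarkovKernel (κ t)]
    (hreal : ∀ (t : ℝ≥0) (x : GaugeConfig 3 L (Matrix.specialUnitaryGroup (Fin 2) ℂ))
        (Ω : Type) [MeasurableSpace Ω] (P : Measure Ω) [IsProbabilityMeasure P]
        (W : ℝ≥0 → Ω → (Edge 3 L × NoiseIdx 2 → ℝ)) (hW : IsFlatBrownian W P)
        (U : ℝ≥0 → Ω → GaugeConfig 3 L (Matrix.specialUnitaryGroup (Fin 2) ℂ)),
        (∀ ω, U 0 ω = x) →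
        (latticeLangevinDynamics (fundamentalLatticeRep 2) β').IsSolution (fundamentalRep (Fin 2))
          hW.natFiltration P W U →
        κ t x = P.map (U t))
    {G : GaugeConfig 3 L (Matrix.specialUnitaryGroup (Fin 2) ℂ) → ℝ} (hG : LowerSemicontinuous G)
    {M : ℝ} (h0 : ∀ y, 0 ≤ G y) (hM : ∀ y, G y ≤ M) {t : ℝ≥0} (ht : 0 < (t : ℝ))
    (Q Q' : GaugeConfig 3 L (Matrix.specialUnitaryGroup (Fin 2) ℂ)) :
    |∫ y, G y ∂(κ t Q') - ∫ y, G y ∂(κ t Q)| ≤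
      Real.sqrt ((1 - 12 * |β'|) / (Real.exp (2 * (1 - 12 * |β'|) * (t : ℝ)) - 1)) * M *
        Real.sqrt (torusRiemannDistSq (fundamentalLatticeRep 2) Q Q') := by
  haveI := borelSpace_config L
  have h0' : ∀ y, 0 ≤ M - G y := fun y => by linarith [hM y]
  have hM' : ∀ y, M - G y ≤ M := fun y => by linarith [h0 y]
  have husc : UpperSemicontinuous fun y => M - G y := by
    have h1 : UpperSemicontinuous fun y => -G y := by
      intro y c hc
      have := hG y (-c) (by linarith)
      filter_upwards [this] with y' hy' using by linarith
    have hfun : (fun y => M - G y) = fun y => -G y + M := by funext y; ring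
    rw [hfun]
    exact h1.add upperSemicontinuous_const
  have h := wilson_strongFeller_upperSemicontinuous L β' hβ κ hreal husc h0' hM' ht Q Q'
  have hGm : Measurable G := hG.measurable
  have hGi : ∀ P : GaugeConfig 3 L (Matrix.specialUnitaryGroup (Fin 2) ℂ), Integrable G (κ t P) := fun P =>
    (memLp_of_bounded (a := 0) (b := M) (ae_of_all _ fun y => ⟨h0 y, hM y⟩) hGm.aestronglyMeasurable 1).integrable le_rfl
  have hshift : ∀ P : GaugeConfig 3 L (Matrix.specialUnitaryGroup (Fin 2) ℂ), ∫ y, (M - G y) ∂(κ t P) = M - ∫ y, G y ∂(κ t P) := fun P => by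
    rw [integral_sub (integrable_const M) (hGi P), integral_const, probReal_univ, one_smul]
  rw [hshift Q', hshift Q] at h
  rwa [show M - ∫ y, G y ∂(κ t Q') - (M - ∫ y, G y ∂(κ t Q)) = -(∫ y, G y ∂(κ t Q') - ∫ y, G y ∂(κ t Q)) by ring, abs_neg] at h

end Summit.QuantumFields.YangMills.Theorems.ColdStartUniversality

end
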